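import Summits.Ventures.PercRepro.SevenThreeSeries

/-!
# PercRepro — the `(7,3)` cell: the flats of a coloop-free restriction of nullity two (p3, gen 16)

Let `K ⊆ E` be a finset with `ρ(K) + 2 = |K|` and no coloops (`cyclicPart M K = K`) — the cyclic part of a witness of
nullity two (`SevenThreeCyclic.lean`). With the dual rank `drk K C = ρ(K ∖ C) + |C| − ρ(K)` of `SevenThreeSeries.lean`:
* `nrk_add_two_eq_card_add_drk`: `ρ(U) + 2 = |U| + drk K (K ∖ U)` for every `U ⊆ K`, and `drk K C ≤ 2`;
* `drk_eq_zero_iff` / `drk_eq_one_iff` / `drk_eq_two_iff`: `drk K C = 0` iff `C = ∅`, `= 1` iff `C` is a nonempty set of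
  pairwise series points, `= 2` iff `C` contains two points not in series;
* `mem_flatsRestr_iff_cyc`: `F ⊆ K` is a rank-`r` flat of `M|K` iff `ρ(F) = r` and its complement `C = K ∖ F` is CYCLIC
  (`IsCyc`): removing any single point of `C` keeps its dual rank;
* `Phi_eq_three_types`: `Φ_r(K) = 36·[r = |K| − 2] + 6·#{C : drk = 1, |C| ≥ 2, |K| − |C| − 1 = r} + #{C : drk = 2, cyclic, |K| − |C| = r}`
  — Lemma 27.2 of mine-2's `MINE2-RLS.md` in the primal (`P3-C025-seven-three-plan.md` §9 (R2), M4).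
The three types are the rank-`2` flats `K`, the within-class complements, and the cyclic complements of the plan.
-/

namespace PercRepro

namespace SevenThree

open Finset ThmH SixThree

variable {α : Type*} [DecidableEq α] {M : Matroid α} [M.Finite]

/-- `C` is CYCLIC in `K`: removing any single point keeps the dual rank (the flat condition on `K ∖ C`). -/
def IsCyc (M : Matroid α) [M.Finite] (K C : Finset α) : Prop :=
  ∀ e ∈ C, drk M K (C.erase e) = drk M K C

/-- The rank of a subset of a nullity-two `K`: `ρ(U) + 2 = |U| + drk K (K ∖ U)`. -/
theorem nrk_add_two_eq_card_add_drk {K U : Finset α} (hK2 : nrk M K + 2 = K.card) (hU : U ⊆ K) :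
    nrk M U + 2 = U.card + drk M K (K \ U) := by
  have h := nrk_sdiff_add_card_eq (M := M) K (K \ U)
  rw [Finset.sdiff_sdiff_eq_self hU, Finset.card_sdiff_of_subset hU] at h
  have := Finset.card_le_card hU
  omega

/-- `drk K C ≤ 2` for `C ⊆ K` of nullity two. -/
theorem drk_le_two {K C : Finset α} (hK2 : nrk M K + 2 = K.card) (hC : C ⊆ K) : drk M K C ≤ 2 := by
  have h := nrk_add_two_eq_card_add_drk hK2 (Finset.sdiff_subset : K \ C ⊆ K)
  rw [Finset.sdiff_sdiff_eq_self hC] at h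
  have := nrk_le_card (M := M) (K \ C)
  omega

/-- `drk K C = 0 ↔ C = ∅` for `C ⊆ K` coloop-free. -/
theorem drk_eq_zero_iff {K C : Finset α} (hK : K ⊆ gr M) (hcf : cyclicPart M K = K) (hC : C ⊆ K) :
    drk M K C = 0 ↔ C = ∅ := by
  constructor
  · intro h
    by_contra hne
    have := one_le_drk_of_nonempty hK (by rw [hcf]; exact hC) (Finset.nonempty_iff_ne_empty.2 hne)
    omega
  · rintro rfl
    exact drk_empty K

/-- `drk K C = 1 ↔ C` is a nonempty set of pairwise series points (`C ⊆ K` coloop-free). -/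
theorem drk_eq_one_iff {K C : Finset α} (hK : K ⊆ gr M) (hcf : cyclicPart M K = K) (hC : C ⊆ K) :
    drk M K C = 1 ↔ C.Nonempty ∧ ∀ e ∈ C, ∀ f ∈ C, Ser M K e f := by
  constructor
  · intro h
    refine ⟨?_, pairwise_ser_of_drk_le_one hK (by rw [hcf]; exact hC) (by omega)⟩
    by_contra hne
    rw [Finset.not_nonempty_iff_eq_empty] at hne
    subst hne
    rw [drk_empty] at h
    omega
  · rintro ⟨hne, hser⟩
    exact drk_eq_one_of_pairwise_ser hK (by rw [hcf]; exact hC) hne hser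

/-- `drk K C = 2 ↔ C` contains two points not in series (`C ⊆ K` of nullity two, coloop-free). -/
theorem drk_eq_two_iff {K C : Finset α} (hK : K ⊆ gr M) (hK2 : nrk M K + 2 = K.card) (hcf : cyclicPart M K = K)
    (hC : C ⊆ K) : drk M K C = 2 ↔ ∃ e ∈ C, ∃ f ∈ C, ¬ Ser M K e f := by
  constructor
  · intro h
    by_contra hcon
    have hser : ∀ e ∈ C, ∀ f ∈ C, Ser M K e f := by
      intro e he f hf
      by_contra hns
      exact hcon ⟨e, he, f, hf, hns⟩
    by_cases hne : C = ∅
    · subst hne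
      rw [drk_empty] at h
      omega
    · have := drk_eq_one_of_pairwise_ser hK (by rw [hcf]; exact hC) (Finset.nonempty_iff_ne_empty.2 hne) hser
      omega
  · rintro ⟨e, he, f, hf, hns⟩
    have hne : e ≠ f := fun hh => hns (Or.inl hh)
    have h1 := two_le_drk_of_not_ser hK (by rw [hcf]; exact hC he) he hf hne hns
    have h2 := drk_le_two hK2 hC
    omega

/-- A set of dual rank `1` in `K` is a nonempty subset of one series class: all its points are in series with any of
them. -/
theorem subset_serClass_of_drk_eq_one {K C : Finset α} (hK : K ⊆ gr M) (hcf : cyclicPart M K = K) (hC : C ⊆ K)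
    (h : drk M K C = 1) {e : α} (he : e ∈ C) : ∀ f ∈ C, Ser M K e f :=
  fun f hf => ((drk_eq_one_iff hK hcf hC).1 h).2 e he f hf

/-- The flats of `M|K` through the dual rank: `F ∈ flatsRestr M K r ↔ F ⊆ K ∧ nrk F = r ∧ IsCyc K (K ∖ F)`. -/
theorem mem_flatsRestr_iff_cyc {K F : Finset α} (hK2 : nrk M K + 2 = K.card) {r : ℕ} :
    F ∈ flatsRestr M K r ↔ F ⊆ K ∧ nrk M F = r ∧ IsCyc M K (K \ F) := by
  rw [mem_flatsRestr]
  constructor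
  · rintro ⟨hFK, hFr, hfl⟩
    refine ⟨hFK, nrk_eq_of_eRk hFr, ?_⟩
    intro e he
    rw [Finset.mem_sdiff] at he
    have h1 := hfl e he.1 he.2
    have h2 : nrk M (insert e F) = r + 1 := nrk_eq_of_eRk h1
    have h3 := nrk_add_two_eq_card_add_drk hK2 (Finset.insert_subset he.1 hFK)
    have h4 := nrk_add_two_eq_card_add_drk hK2 hFK
    have h5 : K \ insert e F = (K \ F).erase e := by
      ext x
      simp only [Finset.mem_sdiff, Finset.mem_insert, Finset.mem_erase]
      tauto
    rw [h5, h2, Finset.card_insert_of_notMem he.2] at h3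
    rw [nrk_eq_of_eRk hFr] at h4
    omega
  · rintro ⟨hFK, hFr, hcyc⟩
    refine ⟨hFK, by rw [← coe_nrk, hFr], ?_⟩
    intro e heK heF
    have h1 := hcyc e (Finset.mem_sdiff.2 ⟨heK, heF⟩)
    have h3 := nrk_add_two_eq_card_add_drk hK2 (Finset.insert_subset heK hFK)
    have h4 := nrk_add_two_eq_card_add_drk hK2 hFK
    have h5 : K \ insert e F = (K \ F).erase e := by
      ext x
      simp only [Finset.mem_sdiff, Finset.mem_insert, Finset.mem_erase]
      tauto
    rw [h5, h1, Finset.card_insert_of_notMem heF] at h3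
    rw [hFr] at h4
    rw [← coe_nrk]
    congr 1
    omega

/-- The weight of a flat `F = K ∖ C` of `M|K` is `6^{2 − drk K C}`, and its rank is `|K| − |C| − 2 + drk K C`. -/
theorem card_sub_nrk_of_subset {K F : Finset α} (hK2 : nrk M K + 2 = K.card) (hF : F ⊆ K) :
    F.card - nrk M F = 2 - drk M K (K \ F) := by
  have h := nrk_add_two_eq_card_add_drk hK2 hF
  omega

open scoped Classical in
/-- The complement map is a bijection of the subsets of `K`, so `Φ_r(K)` is a sum over the cyclic complements. -/
theorem Phi_eq_sum_compl {K : Finset α} (hK2 : nrk M K + 2 = K.card) (r : ℕ) :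
    Phi M r K = ∑ C ∈ K.powerset.filter (fun C => IsCyc M K C ∧ K.card - C.card + drk M K C = r + 2),
      (6 : ℚ) ^ (2 - drk M K C) := by
  classical
  unfold Phi
  refine Finset.sum_nbij' (fun F => K \ F) (fun C => K \ C) ?_ ?_ ?_ ?_ ?_
  · intro F hF
    rw [mem_flatsRestr_iff_cyc hK2] at hF
    obtain ⟨hFK, hFr, hcyc⟩ := hF
    rw [Finset.mem_filter, Finset.mem_powerset]
    refine ⟨Finset.sdiff_subset, hcyc, ?_⟩
    have h1 := nrk_add_two_eq_card_add_drk hK2 hFK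
    rw [Finset.card_sdiff_of_subset hFK]
    rw [hFr] at h1
    have := Finset.card_le_card hFK
    omega
  · intro C hC
    rw [Finset.mem_filter, Finset.mem_powerset] at hC
    obtain ⟨hCK, hcyc, hr⟩ := hC
    rw [mem_flatsRestr_iff_cyc hK2]
    refine ⟨Finset.sdiff_subset, ?_, by rw [Finset.sdiff_sdiff_eq_self hCK]; exact hcyc⟩
    have h1 := nrk_add_two_eq_card_add_drk hK2 (Finset.sdiff_subset : K \ C ⊆ K)
    rw [Finset.sdiff_sdiff_eq_self hCK, Finset.card_sdiff_of_subset hCK] at h1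
    have := Finset.card_le_card hCK
    omega
  · intro F hF
    rw [mem_flatsRestr_iff_cyc hK2] at hF
    exact Finset.sdiff_sdiff_eq_self hF.1
  · intro C hC
    rw [Finset.mem_filter, Finset.mem_powerset] at hC
    exact Finset.sdiff_sdiff_eq_self hC.1
  · intro F hF
    rw [mem_flatsRestr_iff_cyc hK2] at hF
    rw [← hF.2.1, card_sub_nrk_of_subset hK2 hF.1]

/-- `∅` is cyclic. -/
theorem isCyc_empty (K : Finset α) : IsCyc M K ∅ := fun e he => absurd he (Finset.notMem_empty e)

/-- A set of dual rank `1` is cyclic iff it has at least two points. -/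
theorem isCyc_iff_of_drk_eq_one {K C : Finset α} (hK : K ⊆ gr M) (hcf : cyclicPart M K = K) (hC : C ⊆ K)
    (h : drk M K C = 1) : IsCyc M K C ↔ 2 ≤ C.card := by
  obtain ⟨hne, hser⟩ := (drk_eq_one_iff hK hcf hC).1 h
  constructor
  · intro hcyc
    obtain ⟨e, he⟩ := hne
    have h1 := hcyc e he
    rw [h] at h1
    have h2 : (C.erase e).Nonempty := by
      by_contra hcon
      rw [Finset.not_nonempty_iff_eq_empty] at hcon
      rw [hcon, drk_empty] at h1
      omega
    have := Finset.card_pos.2 h2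
    have := Finset.card_erase_add_one he
    omega
  · intro h2 e he
    rw [h]
    apply (drk_eq_one_iff hK hcf ((Finset.erase_subset e C).trans hC)).2
    refine ⟨?_, fun a ha b hb => hser a (Finset.mem_of_mem_erase ha) b (Finset.mem_of_mem_erase hb)⟩
    apply Finset.card_pos.1
    have := Finset.card_erase_add_one he
    omega

open scoped Classical in
/-- The pointwise three-type identity behind `Phi_eq_three_types`. -/
theorem cyc_weight_eq_three_types {K C : Finset α} (hK : K ⊆ gr M) (hK2 : nrk M K + 2 = K.card)
    (hcf : cyclicPart M K = K) (hC : C ⊆ K) (r : ℕ) :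
    (if IsCyc M K C ∧ K.card - C.card + drk M K C = r + 2 then (6 : ℚ) ^ (2 - drk M K C) else 0) =
      (if C = ∅ then (if K.card = r + 2 then (36 : ℚ) else 0) else 0) +
      6 * (if drk M K C = 1 ∧ 2 ≤ C.card ∧ K.card + 1 = r + 2 + C.card then (1 : ℚ) else 0) +
      (if drk M K C = 2 ∧ IsCyc M K C ∧ K.card = r + C.card then (1 : ℚ) else 0) := by
  have hle := drk_le_two hK2 hC
  have hcard := Finset.card_le_card hC
  have h012 : drk M K C = 0 ∨ drk M K C = 1 ∨ drk M K C = 2 := by omega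
  rcases h012 with h0 | h1 | h2
  · have hCe : C = ∅ := (drk_eq_zero_iff hK hcf hC).1 h0
    subst hCe
    have hP1 : IsCyc M K ∅ ∧ K.card - (∅ : Finset α).card + drk M K ∅ = r + 2 ↔ K.card = r + 2 := by
      rw [h0, Finset.card_empty]
      simp only [isCyc_empty, true_and, Nat.sub_zero, add_zero]
    have hP4 : ¬ (drk M K ∅ = 1 ∧ 2 ≤ (∅ : Finset α).card ∧ K.card + 1 = r + 2 + (∅ : Finset α).card) :=
      fun h => by have := h.1; omega
    have hP5 : ¬ (drk M K ∅ = 2 ∧ IsCyc M K ∅ ∧ K.card = r + (∅ : Finset α).card) :=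
      fun h => by have := h.1; omega
    rw [if_neg hP4, if_neg hP5, if_pos rfl]
    by_cases hKr : K.card = r + 2
    · rw [if_pos (hP1.2 hKr), if_pos hKr, h0]
      norm_num
    · rw [if_neg (fun h => hKr (hP1.1 h)), if_neg hKr]
      norm_num
  · have hne : C ≠ ∅ := by
      intro hh
      rw [hh, drk_empty] at h1
      omega
    have hcyc := isCyc_iff_of_drk_eq_one hK hcf hC h1
    have hP1 : IsCyc M K C ∧ K.card - C.card + drk M K C = r + 2 ↔ 2 ≤ C.card ∧ K.card + 1 = r + 2 + C.card := by
      rw [hcyc, h1]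
      constructor <;> rintro ⟨ha, hb⟩ <;> exact ⟨ha, by omega⟩
    have hP5 : ¬ (drk M K C = 2 ∧ IsCyc M K C ∧ K.card = r + C.card) := fun h => by have := h.1; omega
    rw [if_neg hne, if_neg hP5]
    by_cases hc : 2 ≤ C.card ∧ K.card + 1 = r + 2 + C.card
    · rw [if_pos (hP1.2 hc), if_pos ⟨h1, hc⟩, h1]
      norm_num
    · rw [if_neg (fun h => hc (hP1.1 h)), if_neg (fun h => hc h.2)]
      norm_num
  · have hne : C ≠ ∅ := by
      intro hh
      rw [hh, drk_empty] at h2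
      omega
    have hP1 : IsCyc M K C ∧ K.card - C.card + drk M K C = r + 2 ↔ IsCyc M K C ∧ K.card = r + C.card := by
      rw [h2]
      constructor <;> rintro ⟨ha, hb⟩ <;> exact ⟨ha, by omega⟩
    have hP4 : ¬ (drk M K C = 1 ∧ 2 ≤ C.card ∧ K.card + 1 = r + 2 + C.card) := fun h => by have := h.1; omega
    rw [if_neg hne, if_neg hP4]
    by_cases hc : IsCyc M K C ∧ K.card = r + C.card
    · rw [if_pos (hP1.2 hc), if_pos ⟨h2, hc⟩, h2]
      norm_num
    · rw [if_neg (fun h => hc (hP1.1 h)), if_neg (fun h => hc h.2)]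
      norm_num

open scoped Classical in
/-- **Lemma 27.2 (primal), the three types**: for a coloop-free `K` of nullity two,
`Φ_r(K) = 36·[|K| = r + 2] + 6·#{C ⊆ K : drk = 1, |C| ≥ 2, |K| + 1 = r + 2 + |C|} + #{C ⊆ K : drk = 2, cyclic, |K| = r + |C|}`. -/
theorem Phi_eq_three_types {K : Finset α} (hK : K ⊆ gr M) (hK2 : nrk M K + 2 = K.card) (hcf : cyclicPart M K = K)
    (r : ℕ) :
    Phi M r K = (if K.card = r + 2 then (36 : ℚ) else 0) +
      6 * (((K.powerset.filter (fun C => drk M K C = 1 ∧ 2 ≤ C.card ∧ K.card + 1 = r + 2 + C.card)).card : ℕ) : ℚ) +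
      (((K.powerset.filter (fun C => drk M K C = 2 ∧ IsCyc M K C ∧ K.card = r + C.card)).card : ℕ) : ℚ) := by
  rw [Phi_eq_sum_compl hK2 r, Finset.sum_filter, Finset.card_filter, Finset.card_filter, Nat.cast_sum, Nat.cast_sum,
    Finset.mul_sum]
  have hempty : (if K.card = r + 2 then (36 : ℚ) else 0) =
      ∑ C ∈ K.powerset, (if C = ∅ then (if K.card = r + 2 then (36 : ℚ) else 0) else 0) := by
    rw [Finset.sum_ite_eq' K.powerset ∅ (fun _ => if K.card = r + 2 then (36 : ℚ) else 0)]
    rw [if_pos (Finset.empty_mem_powerset K)]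
  rw [hempty, ← Finset.sum_add_distrib, ← Finset.sum_add_distrib]
  apply Finset.sum_congr rfl
  intro C hC
  rw [Finset.mem_powerset] at hC
  have := cyc_weight_eq_three_types hK hK2 hcf hC r
  push_cast at this ⊢
  rw [this]

end SevenThree

end PercRepro
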